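import Mathlib
import Summits.CriticalPhenomena.PercolationContinuityZ3.Theorems.PercNearOneGluingNoHeavyQuantTwoArcHairsTwoSided
import HarnessLib

/-!
# QUANT lane R8, "FAR beyond trees", layer one on hairy cycles — expectation over hair patterns and the TRUNCATION TO PAIRS (STEP 1, abstract form)

builds on p205010 (kernel theorem, internal audit signed; external expert review pending)

Support file (`--supports stmt-CriticalPhenomena-4575`), seat `prim-quant-p1` (gen 17); memo `quant/prim-quant-p1-g17/FOR-LEAD-TWOCHAIN-B.md` §6 and
`quant/prim-quant-p1-g17/FOR-PROVERS-TWOARC-BRIDGE.md`.  Continues `…QuantTwoArcHairs(TwoSided)`.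
`expect f ks Ψ = Σ_{Q ⊆ ks} w(Q) Ψ(Q)` is the expectation over the random set of open companion hairs of an INDEXED list `ks : List ι` with data
`f : ι → HComp` (`w(Q) = ∏_Q h ∏_{ks∖Q}(1 − h)`, the pattern handed over as the sublist of open indices, so that a law-level integrand can read positions);
`expect2 fL fR L R Ψ` is the two-sided version.  If `Ψ` is "P(N ≥ 2 | open companions) − x" of a two-chain / sun law with a SURE distinguished relay, its
values on patterns with at most two open companion hairs are the pair data of the abstract system (`−x`, `−A_k c_k`, same-side `Φ_jk`, mixed
`(p_R − c'_j)(p_L − c_k)`) and `Ψ ≥ 0` on patterns with three or more open hairs (the middle of three positions is covered only if an outer one is);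
then **`expect2_ge_F2W`**: `E Ψ ≥ F₂`, and with `F2W_nonneg'` **`expect2_nonneg`: `E Ψ ≥ 0`**, i.e. `P(N ≥ 2) ≥ x`.  This is g16's STEP 1 with the law
abstracted into hypotheses on `Ψ`; the dictionary from prim-cert-1's `sunLaw` to such a `Ψ` is the last step (`FOR-PROVERS-TWOARC-BRIDGE.md`).
* `expect`, `expect2`, `expect_nonneg/const/add/smul/append`, `zW_nonneg'`, `zW_map_cons`; truncation lemmas `expect_ge_empty` (level 0), `expect_ge_one`
  (level 1, `≥ a₀ Z + s1W·t`), `expect_ge_cross` (level 1 with cross values, `≥ −e Z + gW·t`), **`expect_ge_FW`** (one side), **`expect2_ge_F2W`** (two sides);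
* empty sides: `F2W_nil_left/right`, **`F2W_nonneg'`** (`F₂ ≥ 0` in regime A, either side possibly empty); **`expect2_nonneg`** (master corollary).
Pure real algebra on lists; new definitions `expect`, `expect2`; standard axioms; no sorries. [this work]
-/

namespace Summit.CriticalPhenomena.PercolationContinuityZ3.Theorems

namespace Quant

namespace TwoArc

/-- `Z ≥ 0` from the hair bounds alone. [this work] -/
theorem zW_nonneg' (ks : List HComp) (hh : ∀ k ∈ ks, 0 ≤ k.h ∧ k.h ≤ 1) : 0 ≤ zW ks := by
  induction ks with
  | nil => simp
  | cons k ks ih => rw [zW_cons]; exact mul_nonneg (by linarith [(hh k (by simp)).2]) (ih fun l hl => hh l (by simp [hl]))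

/-! ## Expectation over the open-hair pattern (indexed companions) and the truncation to at most two open companion hairs -/

variable {ι : Type*}

/-- Expectation over the random set of open hairs of an INDEXED list of companions `ks : List ι` with data `f : ι → HComp` (hair `k` open with
probability `(f k).h`, independently): `expect f ks Ψ = Σ_{Q ⊆ ks} (∏_Q h)(∏_{ks∖Q}(1−h)) Ψ(Q)`, the pattern `Q` handed to `Ψ` as the sublist of open
indices (so that a law-level integrand can read positions off the indices). [this work] -/
noncomputable def expect (f : ι → HComp) : List ι → (List ι → ℝ) → ℝ
  | [], Ψ => Ψ []
  | k :: ks, Ψ => (f k).h * expect f ks (fun Q => Ψ (k :: Q)) + (1 - (f k).h) * expect f ks Ψ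

variable {p c₁ : ℝ} (f : ι → HComp)

/-- `expect` recursion. [this work] -/
@[simp] theorem expect_cons (k : ι) (ks : List ι) (Ψ : List ι → ℝ) :
    expect f (k :: ks) Ψ = (f k).h * expect f ks (fun Q => Ψ (k :: Q)) + (1 - (f k).h) * expect f ks Ψ := rfl
/-- `expect` on the empty list. [this work] -/
@[simp] theorem expect_nil (Ψ : List ι → ℝ) : expect f [] Ψ = Ψ [] := rfl

/-- `Z` of the mapped list, recursion. [this work] -/
theorem zW_map_cons (k : ι) (ks : List ι) : zW ((k :: ks).map f) = (1 - (f k).h) * zW (ks.map f) := by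
  simp [zW_cons]

/-- A non-negative integrand has non-negative expectation (hairs in `[0,1]`). [this work] -/
theorem expect_nonneg {ks : List ι} (hh : ∀ k ∈ ks, 0 ≤ (f k).h ∧ (f k).h ≤ 1) {Ψ : List ι → ℝ} (hΨ : ∀ Q, 0 ≤ Ψ Q) :
    0 ≤ expect f ks Ψ := by
  induction ks generalizing Ψ with
  | nil => simpa using hΨ []
  | cons k ks ih =>
    have hk := hh k (by simp)
    rw [expect_cons]
    exact add_nonneg (mul_nonneg hk.1 (ih (fun l hl => hh l (by simp [hl])) (fun Q => hΨ _)))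
      (mul_nonneg (by linarith [hk.2]) (ih (fun l hl => hh l (by simp [hl])) hΨ))

/-- Expectation of a constant. [this work] -/
theorem expect_const (ks : List ι) (c : ℝ) : expect f ks (fun _ => c) = c := by
  induction ks with
  | nil => simp
  | cons k ks ih => simp [expect_cons, ih]; ring

/-- `expect` is additive in the integrand. [this work] -/
theorem expect_add (ks : List ι) (Ψ₁ Ψ₂ : List ι → ℝ) :
    expect f ks (fun Q => Ψ₁ Q + Ψ₂ Q) = expect f ks Ψ₁ + expect f ks Ψ₂ := by
  induction ks generalizing Ψ₁ Ψ₂ with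
  | nil => simp
  | cons k ks ih => simp only [expect_cons]; rw [ih, ih]; ring

/-- `expect` scales. [this work] -/
theorem expect_smul (ks : List ι) (c : ℝ) (Ψ : List ι → ℝ) :
    expect f ks (fun Q => c * Ψ Q) = c * expect f ks Ψ := by
  induction ks generalizing Ψ with
  | nil => simp
  | cons k ks ih => simp only [expect_cons]; rw [ih, ih]; ring

/-- Truncation, level 0: if `Ψ(Q) ≥ 0` for every non-empty pattern then `expect ≥ Ψ(∅)·Z`. [this work] -/
theorem expect_ge_empty {ks : List ι} (hh : ∀ k ∈ ks, 0 ≤ (f k).h ∧ (f k).h ≤ 1) {Ψ : List ι → ℝ}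
    (hΨ : ∀ Q, Q ≠ [] → 0 ≤ Ψ Q) : Ψ [] * zW (ks.map f) ≤ expect f ks Ψ := by
  induction ks generalizing Ψ with
  | nil => simp
  | cons k ks ih =>
    have hk := hh k (by simp)
    rw [expect_cons, zW_map_cons]
    have h1 : 0 ≤ expect f ks (fun Q => Ψ (k :: Q)) :=
      expect_nonneg f (fun l hl => hh l (by simp [hl])) (fun Q => hΨ _ (by simp))
    have h2 := ih (fun l hl => hh l (by simp [hl])) (Ψ := Ψ) (fun Q hQ => hΨ Q hQ)
    nlinarith [hk.1, hk.2, mul_le_mul_of_nonneg_left h2 (by linarith [hk.2] : (0:ℝ) ≤ 1 - (f k).h)]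

/-- Truncation, level 1 (the income of a fixed earlier companion `k`), with lower bounds: if `a₀ ≤ Ψ(∅)`, `Φ_kl·t ≤ Ψ({l})` and `Ψ(Q) ≥ 0`
for `|Q| ≥ 2`, then `a₀·Z + s1W k · t ≤ expect Ψ`. [this work] -/
theorem expect_ge_one (k : HComp) {ks : List ι} (hh : ∀ l ∈ ks, 0 ≤ (f l).h ∧ (f l).h ≤ 1) {Ψ : List ι → ℝ} {a₀ t : ℝ}
    (h0 : a₀ ≤ Ψ []) (h1 : ∀ l ∈ ks, Comp.phi p c₁ (k.toComp p) ((f l).toComp p) * t ≤ Ψ [l])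
    (h2 : ∀ Q : List ι, 2 ≤ Q.length → 0 ≤ Ψ Q) :
    a₀ * zW (ks.map f) + s1W p c₁ k (ks.map f) * t ≤ expect f ks Ψ := by
  induction ks generalizing Ψ with
  | nil => simpa [s1W] using h0
  | cons l ls ih =>
    have hl := hh l (by simp)
    rw [expect_cons, zW_map_cons]
    simp only [List.map_cons, s1W]
    have hA : Comp.phi p c₁ (k.toComp p) ((f l).toComp p) * t * zW (ls.map f) ≤ expect f ls (fun Q => Ψ (l :: Q)) := by
      have h := expect_ge_empty f (ks := ls) (fun m hm => hh m (by simp [hm])) (Ψ := fun Q => Ψ (l :: Q))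
        (fun Q hQ => h2 _ (by cases Q with | nil => exact absurd rfl hQ | cons _ _ => simp))
      have hv := h1 l (by simp)
      have hz := zW_nonneg' (ls.map f) (by intro m hm; obtain ⟨n, hn, rfl⟩ := List.mem_map.mp hm; exact hh n (by simp [hn]))
      nlinarith [mul_le_mul_of_nonneg_right hv hz]
    have hB := ih (fun m hm => hh m (by simp [hm])) (Ψ := Ψ) h0 (fun m hm => h1 m (by simp [hm])) h2
    nlinarith [mul_le_mul_of_nonneg_left hA hl.1, mul_le_mul_of_nonneg_left hB (by linarith [hl.2] : (0:ℝ) ≤ 1 - (f l).h)]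

/-- **Truncation to pairs, one side.**  If `Ψ(∅) = −x`, `Ψ({k}) = −e_k`, `Ψ({j,k}) = Φ_jk` (j earlier) and `Ψ(Q) ≥ 0` for `|Q| ≥ 3`, then
`expect Ψ ≥ F = P₂ − P₁ − xZ` (`FW` of the mapped list). [this work] -/
theorem expect_ge_FW {ks : List ι} (hh : ∀ k ∈ ks, 0 ≤ (f k).h ∧ (f k).h ≤ 1) {Ψ : List ι → ℝ}
    (h0 : Ψ [] = -xv p c₁) (h1 : ∀ k ∈ ks, Ψ [k] = -((f k).A * (f k).c))
    (h2 : ks.Pairwise (fun j k => Ψ [j, k] = Comp.phi p c₁ ((f j).toComp p) ((f k).toComp p)))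
    (h3 : ∀ Q : List ι, 3 ≤ Q.length → 0 ≤ Ψ Q) :
    FW p c₁ (ks.map f) ≤ expect f ks Ψ := by
  induction ks generalizing Ψ with
  | nil => simp [FW, p2W, p1W, h0]
  | cons k ks ih =>
    have hk := hh k (by simp)
    rcases List.pairwise_cons.mp h2 with ⟨h2k, h2'⟩
    rw [expect_cons]
    have hA : -((f k).A * (f k).c) * zW (ks.map f) + s1W p c₁ (f k) (ks.map f) * 1 ≤ expect f ks (fun Q => Ψ (k :: Q)) :=
      expect_ge_one f (f k) (fun l hl => hh l (by simp [hl])) (Ψ := fun Q => Ψ (k :: Q)) (le_of_eq (h1 k (by simp)).symm)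
        (fun l hl => by rw [mul_one, h2k l hl]) (fun Q hQ => h3 _ (by simp only [List.length_cons]; omega))
    have hB := ih (fun l hl => hh l (by simp [hl])) (Ψ := Ψ) h0 (fun l hl => h1 l (by simp [hl])) h2' h3
    have e : FW p c₁ ((k :: ks).map f) = (f k).h * (-((f k).A * (f k).c) * zW (ks.map f) + s1W p c₁ (f k) (ks.map f))
        + (1 - (f k).h) * FW p c₁ (ks.map f) := by
      simp only [List.map_cons, FW, p2W, p1W, zW_cons]; ring
    rw [e]
    rw [mul_one] at hA
    nlinarith [mul_le_mul_of_nonneg_left hA hk.1, mul_le_mul_of_nonneg_left hB (by linarith [hk.2] : (0:ℝ) ≤ 1 - (f k).h)]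

/-- Two-sided expectation: left pattern then right pattern (data `fL`, `fR`). [this work] -/
noncomputable def expect2 (fL fR : ι → HComp) (L R : List ι) (Ψ : List ι → List ι → ℝ) : ℝ :=
  expect fL L (fun QL => expect fR R (fun QR => Ψ QL QR))

/-- Truncation, level 1 with cross values: `Σ_j w({j}) (c − c_j)·t + Ψ(∅) Z ≤ expect Ψ`. [this work] -/
theorem expect_ge_cross (c : ℝ) {ks : List ι} (hh : ∀ k ∈ ks, 0 ≤ (f k).h ∧ (f k).h ≤ 1) {Ψ : List ι → ℝ} {e t : ℝ}
    (h0 : Ψ [] = -e) (h1 : ∀ l ∈ ks, Ψ [l] = (c - (f l).c) * t) (h2 : ∀ Q : List ι, 2 ≤ Q.length → 0 ≤ Ψ Q) :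
    -e * zW (ks.map f) + gW c (ks.map f) * t ≤ expect f ks Ψ := by
  induction ks generalizing Ψ with
  | nil => simp [h0]
  | cons l ls ih =>
    have hl := hh l (by simp)
    rw [expect_cons, zW_map_cons]
    simp only [List.map_cons, gW_cons]
    have hA : (c - (f l).c) * t * zW (ls.map f) ≤ expect f ls (fun Q => Ψ (l :: Q)) := by
      have := expect_ge_empty f (ks := ls) (fun m hm => hh m (by simp [hm])) (Ψ := fun Q => Ψ (l :: Q))
        (fun Q hQ => h2 _ (by cases Q with | nil => exact absurd rfl hQ | cons _ _ => simp))
      simpa [h1 l (by simp)] using this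
    have hB := ih (fun m hm => hh m (by simp [hm])) (Ψ := Ψ) h0 (fun m hm => h1 m (by simp [hm])) h2
    nlinarith [mul_le_mul_of_nonneg_left hA hl.1, mul_le_mul_of_nonneg_left hB (by linarith [hl.2] : (0:ℝ) ≤ 1 - (f l).h)]

/-- **Truncation to pairs, two sides.**  Left indices `L` with data `fL` (system `(p_L, p_R)`), right indices `R` with data `fR` (system `(p_R, p_L)`),
`Ψ(Q_L, Q_R)` = "P(N ≥ 2 | open companions) − x" with: `Ψ(∅,∅) = −x`, singletons `−A c`, same-side pairs `Φ`, mixed pairs `(p_R − c'_j)(p_L − c_k)`, and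
`Ψ ≥ 0` when three or more companion hairs are open.  Then `expect2 Ψ ≥ F₂` (`F2W` of the mapped lists). [this work] -/
theorem expect2_ge_F2W (pL pR : ℝ) (fL fR : ι → HComp) {L R : List ι}
    (hhL : ∀ k ∈ L, 0 ≤ (fL k).h ∧ (fL k).h ≤ 1) (hhR : ∀ k ∈ R, 0 ≤ (fR k).h ∧ (fR k).h ≤ 1)
    {Ψ : List ι → List ι → ℝ}
    (h00 : Ψ [] [] = -xv pL pR)
    (hL1 : ∀ j ∈ L, Ψ [j] [] = -((fL j).A * (fL j).c)) (hR1 : ∀ k ∈ R, Ψ [] [k] = -((fR k).A * (fR k).c))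
    (hL2 : L.Pairwise (fun j j' => Ψ [j, j'] [] = Comp.phi pL pR ((fL j).toComp pL) ((fL j').toComp pL)))
    (hR2 : R.Pairwise (fun k k' => Ψ [] [k, k'] = Comp.phi pR pL ((fR k).toComp pR) ((fR k').toComp pR)))
    (hX : ∀ j ∈ L, ∀ k ∈ R, Ψ [j] [k] = (pR - (fL j).c) * (pL - (fR k).c))
    (h3 : ∀ QL QR : List ι, 3 ≤ QL.length + QR.length → 0 ≤ Ψ QL QR) :
    F2W pL pR (L.map fL) (R.map fR) ≤ expect2 fL fR L R Ψ := by
  have inner0 : FW pR pL (R.map fR) ≤ expect fR R (fun QR => Ψ [] QR) :=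
    expect_ge_FW (p := pR) (c₁ := pL) fR hhR (Ψ := fun QR => Ψ [] QR) (by rw [h00, xv_comm]) hR1 hR2
      (fun Q hQ => h3 [] Q (by simp; omega))
  have inner1 : ∀ j ∈ L, -((fL j).A * (fL j).c) * zW (R.map fR) + gW pL (R.map fR) * (pR - (fL j).c)
      ≤ expect fR R (fun QR => Ψ [j] QR) := fun j hj =>
    expect_ge_cross fR pL hhR (Ψ := fun QR => Ψ [j] QR) (hL1 j hj) (fun k hk => by rw [hX j hj k hk]; ring)
      (fun Q hQ => h3 [j] Q (by simp; omega))
  have inner2 : ∀ j j' : ι, Ψ [j, j'] [] * zW (R.map fR) ≤ expect fR R (fun QR => Ψ [j, j'] QR) := fun j j' =>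
    expect_ge_empty fR hhR (Ψ := fun QR => Ψ [j, j'] QR) (fun Q hQ => h3 _ _ (by
      cases Q with | nil => exact absurd rfl hQ | cons _ _ => simp only [List.length_cons, List.length_nil]; omega))
  have inner3 : ∀ QL : List ι, 3 ≤ QL.length → 0 ≤ expect fR R (fun QR => Ψ QL QR) := fun QL hQL =>
    expect_nonneg fR hhR (fun Q => h3 _ _ (by omega))
  suffices main : ∀ (L : List ι), (∀ k ∈ L, 0 ≤ (fL k).h ∧ (fL k).h ≤ 1) → ∀ (Θ : List ι → ℝ),
      FW pR pL (R.map fR) ≤ Θ [] → (∀ j ∈ L, -((fL j).A * (fL j).c) * zW (R.map fR) + gW pL (R.map fR) * (pR - (fL j).c) ≤ Θ [j]) →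
      L.Pairwise (fun j j' => Comp.phi pL pR ((fL j).toComp pL) ((fL j').toComp pL) * zW (R.map fR) ≤ Θ [j, j']) →
      (∀ QL : List ι, 3 ≤ QL.length → 0 ≤ Θ QL) → F2W pL pR (L.map fL) (R.map fR) ≤ expect fL L Θ by
    exact main L hhL _ inner0 inner1
      (hL2.imp_of_mem (by intro j j' hj hj' h; rw [← h]; exact inner2 j j')) inner3
  intro L
  induction L with
  | nil =>
    intro _ Θ t0 _ _ _
    simp only [List.map_nil, F2W, zW_nil, gW_nil, expect_nil, one_mul, zero_mul, mul_one, add_zero]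
    have : FW pL pR [] = -xv pL pR := by simp [FW, p2W, p1W]
    rw [this]; linarith
  | cons j js ih =>
    intro hh Θ t0 t1 t2 t3
    have hj := hh j (by simp)
    rcases List.pairwise_cons.mp t2 with ⟨t2j, t2'⟩
    rw [expect_cons]
    have hB := ih (fun l hl => hh l (by simp [hl])) Θ t0 (fun l hl => t1 l (by simp [hl])) t2' t3
    have hA : (-((fL j).A * (fL j).c) * zW (R.map fR) + gW pL (R.map fR) * (pR - (fL j).c)) * zW (js.map fL)
        + s1W pL pR (fL j) (js.map fL) * zW (R.map fR) ≤ expect fL js (fun Q => Θ (j :: Q)) :=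
      expect_ge_one (p := pL) (c₁ := pR) fL (fL j) (fun l hl => hh l (by simp [hl])) (Ψ := fun Q => Θ (j :: Q)) (t1 j (by simp))
        (fun l hl => t2j l hl) (fun Q hQ => t3 _ (by simp only [List.length_cons]; omega))
    have e : F2W pL pR ((j :: js).map fL) (R.map fR)
        = (fL j).h * ((-((fL j).A * (fL j).c) * zW (R.map fR) + gW pL (R.map fR) * (pR - (fL j).c)) * zW (js.map fL)
          + s1W pL pR (fL j) (js.map fL) * zW (R.map fR)) + (1 - (fL j).h) * F2W pL pR (js.map fL) (R.map fR) := by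
      simp only [List.map_cons, F2W, FW, p2W, p1W, zW_cons, gW_cons]; ring
    rw [e]
    nlinarith [mul_le_mul_of_nonneg_left hA hj.1, mul_le_mul_of_nonneg_left hB (by linarith [hj.2] : (0:ℝ) ≤ 1 - (fL j).h)]

/-- Concatenation: the expectation over `L ++ R` is the nested expectation (used to pass from one indexed list of all companions to the
two-sided form). [this work] -/
theorem expect_append (f : ι → HComp) (L R : List ι) (Ψ : List ι → ℝ) :
    expect f (L ++ R) Ψ = expect f L (fun QL => expect f R (fun QR => Ψ (QL ++ QR))) := by
  induction L generalizing Ψ with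
  | nil => simp
  | cons j js ih => simp only [List.cons_append, expect_cons, ih]


/-! ## Empty sides -/

/-- With no left companions the two-sided w-form is the right one-sided w-form. [this work] -/
theorem F2W_nil_left (pL pR : ℝ) (R : List HComp) : F2W pL pR [] R = FW pR pL R := by
  simp only [F2W, FW, p2W, p1W, gW, zW, xv_comm pL pR]; ring

/-- With no right companions the two-sided w-form is the left one-sided w-form. [this work] -/
theorem F2W_nil_right (pL pR : ℝ) (L : List HComp) : F2W pL pR L [] = FW pL pR L := by
  rw [F2W_comm, F2W_nil_left]

/-- **`F₂ ≥ 0` in regime A for every configuration with at least one companion** (either side may be empty): `F2W_nonneg` + the one-sided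
`FW_nonneg`. [this work] -/
theorem F2W_nonneg' (pL pR : ℝ) (hpL : 0 ≤ pL) (hpL1 : pL ≤ 1) (hpR : 0 ≤ pR) (hpR1 : pR ≤ 1)
    (L R : List HComp) (hne : L ≠ [] ∨ R ≠ [])
    (admL : ∀ k ∈ L, HComp.Adm pL pR k) (admR : ∀ k ∈ R, HComp.Adm pR pL k)
    (hAL : L.Pairwise (fun j k => j.A ≤ k.A)) (hcL : L.Pairwise (fun j k => k.c ≤ j.c))
    (hAR : R.Pairwise (fun j k => j.A ≤ k.A)) (hcR : R.Pairwise (fun j k => k.c ≤ j.c))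
    (hσ : 1 ≤ sigW pL L + sigW pR R) : 0 ≤ F2W pL pR L R := by
  by_cases hL : L = []
  · subst hL
    have hR : R ≠ [] := by rcases hne with h | h; exact absurd rfl h; exact h
    rw [F2W_nil_left]
    exact FW_nonneg hpR hpR1 hpL1 R hR admR hAR hcR (by simpa using hσ)
  by_cases hR : R = []
  · subst hR
    rw [F2W_nil_right]
    exact FW_nonneg hpL hpL1 hpR1 L hL admL hAL hcL (by simpa using hσ)
  exact F2W_nonneg pL pR hpL hpL1 hpR hpR1 L R hL hR admL admR hAL hcL hAR hcR hσ

/-- **MASTER COROLLARY of the pairs-level algebra.**  For indexed companions (either side may be empty but not both), admissible by hair weight,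
ordered, in regime A, and any two-sided integrand `Ψ` with the pair data on at most two open hairs and `≥ 0` beyond:  `0 ≤ expect2 Ψ`, i.e.
`P(N ≥ 2) ≥ x` once `Ψ` = "P(N ≥ 2 | pattern) − x". [this work] -/
theorem expect2_nonneg (pL pR : ℝ) (hpL : 0 ≤ pL) (hpL1 : pL ≤ 1) (hpR : 0 ≤ pR) (hpR1 : pR ≤ 1)
    (fL fR : ι → HComp) (L R : List ι) (hne : L ≠ [] ∨ R ≠ [])
    (admL : ∀ k ∈ L, HComp.Adm pL pR (fL k)) (admR : ∀ k ∈ R, HComp.Adm pR pL (fR k))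
    (hAL : L.Pairwise (fun j k => (fL j).A ≤ (fL k).A)) (hcL : L.Pairwise (fun j k => (fL k).c ≤ (fL j).c))
    (hAR : R.Pairwise (fun j k => (fR j).A ≤ (fR k).A)) (hcR : R.Pairwise (fun j k => (fR k).c ≤ (fR j).c))
    (hσ : 1 ≤ sigW pL (L.map fL) + sigW pR (R.map fR))
    {Ψ : List ι → List ι → ℝ}
    (h00 : Ψ [] [] = -xv pL pR)
    (hL1 : ∀ j ∈ L, Ψ [j] [] = -((fL j).A * (fL j).c)) (hR1 : ∀ k ∈ R, Ψ [] [k] = -((fR k).A * (fR k).c))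
    (hL2 : L.Pairwise (fun j j' => Ψ [j, j'] [] = Comp.phi pL pR ((fL j).toComp pL) ((fL j').toComp pL)))
    (hR2 : R.Pairwise (fun k k' => Ψ [] [k, k'] = Comp.phi pR pL ((fR k).toComp pR) ((fR k').toComp pR)))
    (hX : ∀ j ∈ L, ∀ k ∈ R, Ψ [j] [k] = (pR - (fL j).c) * (pL - (fR k).c))
    (h3 : ∀ QL QR : List ι, 3 ≤ QL.length + QR.length → 0 ≤ Ψ QL QR) :
    0 ≤ expect2 fL fR L R Ψ := by
  have hF := expect2_ge_F2W pL pR fL fR (fun k hk => ⟨(admL k hk).h_nonneg, (admL k hk).h_le⟩)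
    (fun k hk => ⟨(admR k hk).h_nonneg, (admR k hk).h_le⟩) h00 hL1 hR1 hL2 hR2 hX h3
  have hnn := F2W_nonneg' pL pR hpL hpL1 hpR hpR1 (L.map fL) (R.map fR)
    (by rcases hne with h | h; exact Or.inl (by simpa using h); exact Or.inr (by simpa using h))
    (by intro k hk; obtain ⟨m, hm, rfl⟩ := List.mem_map.mp hk; exact admL m hm)
    (by intro k hk; obtain ⟨m, hm, rfl⟩ := List.mem_map.mp hk; exact admR m hm)
    (List.pairwise_map.mpr (hAL.imp (by intro a b h; exact h))) (List.pairwise_map.mpr (hcL.imp (by intro a b h; exact h)))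
    (List.pairwise_map.mpr (hAR.imp (by intro a b h; exact h))) (List.pairwise_map.mpr (hcR.imp (by intro a b h; exact h))) hσ
  linarith

end TwoArc

end Quant

end Summit.CriticalPhenomena.PercolationContinuityZ3.Theorems
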